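import Summits.ABC.IUTFork.Repair.RHHullThresholdExact
import Summits.ABC.IUTFork.Conditional.WRowHexLamSevenTriplesThirtySix
import Summits.ABC.IUTFork.Conditional.WRowHexLamSevenThirtySixRefutedCellsA
import HarnessLib

/-!
# R-W WINDOW numerics, HEX family `λ_k = 1/2 + 2/7^k` at `k = 36`: the REFUTED BAND's INTEGER CELLS, class lemma (part (R-cells); the floor-free piece lemmas are in `…RefutedCellsA.lean`, the W-lane shapes in `…RefutedBand.lean`) —
# top-label `HullCell` failures over the sharp class for `(ratPoint λ_36, l)` for EVERY prime `481 ≤ l ≤ 279156616784327`, e-robustly and UNIFORMLY in `l`; glue: every prime `11 ≤ l ≤ 279156616784327`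

PROOF-ONLY file (D-0012; 0 definitions, 0 `Prop` facts, no instance, no notation) of the abc-iut cell (branch C certificate seat
abc-iut-C-cert-1, gen 9; row «W:HEX-AXIS-REST-4», `k = 36`, part (R); generator gen_ref.py (HOME/staging/C/cert-1/g9/hexgen/, analytic piece plan) from the `k = 10` template p508090 and gen 8's `k = 12…17` files).
TAKES NO SIDE on [IUTchIII] Cor. 3.12 (S. Mochizuki, *Inter-universal Teichmüller theory III*, Cor. 3.12 p. 173–174; Step (xi-f) p. 184) or on any
author; «refuted as typed» ≠ «refuted in print». BEFORE THIS FILE (BY NAME): at `k = 36` the K-line object FAILS at every prime `11 ≤ l ≤ 479` (abc-iut-W-neg-2's `HexRad.not_pilotKummerCompatHull_lamSeven_rad_eleven`, every `k ≥ 11`); no theorem names a level `l ≥ 481`.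
THIS FILE: at the pole `p = 7` of the HEX36 triple `2651730845859653471779023381605 + 2651730845859653471779023381597 = 5303461691719306943558046763202` (`v = v₇(abc) = 36`; prelude `WRowHexLamSevenTriplesThirtySix`) abc-iut-W-neg-1's SHARP local-type
class (`WRow.localType_class_triple_sharp`, p498814 §1) leaves `A ∈ {5}`; per member and turning-point piece
(A = 5: a₀ = 4 on 481 ≤ l ≤ 2881; A = 5: a₀ = 5 on 2883 ≤ l ≤ 20167; A = 5: a₀ = 6 on 20169 ≤ l ≤ 141177; A = 5: a₀ = 7 on 141179 ≤ l ≤ 988251; A = 5: a₀ = 8 on 988253 ≤ l ≤ 6917761; A = 5: a₀ = 9 on 6917763 ≤ l ≤ 48424327; A = 5: a₀ = 10 on 48424329 ≤ l ≤ 338970297; A = 5: a₀ = 11 on 338970299 ≤ l ≤ 2372792091; A = 5: a₀ = 12 on 2372792093 ≤ l ≤ 16609544641; A = 5: a₀ = 13 on 16609544643 ≤ l ≤ 116266812487; A = 5: a₀ = 14 on 116266812489 ≤ l ≤ 813867687417; A = 5: a₀ = 15 on 813867687419 ≤ l ≤ 5697073811931; A = 5: a₀ = 16 on 5697073811933 ≤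 l ≤ 39879516683521; A = 5: a₀ = 17 on 39879516683523 ≤ l ≤ 279156616784323) the top-label cell of R-H row 4's `HullCell` FAILS by a
floor-free downward parabola (`e·⌊X/e⌋ ≥ X − e + 1`, inner radius bounded by `6·r_in ≤ A·l + 6`), and at the literal prime(s) [279156616784327] by the exact floor.
W-neg-1's three sockets (`Cor312LicenceTripleHullCellRefuteTameSharp` §2), transported to `ratPoint ((2 : ℚ)⁻¹ + 2/7^k)`, `k = 36`, give the three W-lane shapes
`WRow.not_licence_lamSeven_thirtySix_band` / `WRow.not_exists_qPinned_and_hull_lamSeven_thirtySix_band` / `GenuineK.not_pilotKummerCompatHull_chosen_lamSeven_thirtySix_band`,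
and the GLUE `GenuineK.not_pilotKummerCompatHull_chosen_lamSeven_thirtySix_le` (every prime `11 ≤ l ≤ 279156616784327`). DESK (two engines agree: this seat's analytic piece plan (gen 8's scan semantics)
and abc-iut-W-num-5 g5's engine C, STATUS 07:20:50Z): the exact top-label cell fails at every prime of the band and first holds at `l = 279156616784387`; the
inhabited band from there is part (I) (`WRow.licence_lamSeven_thirtySix_all`), NOT claimed here. These levels are NOT rows of the R-W WINDOW-TABLE.
HONEST SCOPE: OUR sharp containers and Dupuy–Hilado's typed (Ind1)/(Ind2); the per-label licence is a STRONGER-THAN-PRINT sufficient form of Step (xi-f);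
admissibility / Szpiro-badness / (P6) of `(ratPoint λ_36, l)` and NON-EMPTINESS of the datum type are NOT claimed (a «∀ T» statement is vacuous if no datum
exists); nothing about the printed inequality, the number-level `Cor22.Cor312AtDatum` or any author's intended hull; typed ≠ proved; instantiated ≠ endorsed; no abc claim.
[cite: Mochizuki2012, IUTchI Ex. 3.2 (iv) p. 71; IUTchIII Cor. 3.12 Step (xi-d) p. 183, (xi-f) p. 184; IUTchIV Prop. 1.1 p. 9, Prop. 1.2 (i)(ii) p. 10, Thm. 1.10 p. 22, Cor. 2.2 (ii) proof (P5) p. 46]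
[cite: DupuyHilado2025, §3.3, §3.4, §4.9, §4.12] [cite: SilvermanATAEC1994, V.5 Thm. 5.3 and Cor. 5.4] [claim: Mochizuki2012, status: disputed] for every IUT sentence quoted.
-/

noncomputable section

open Set Function NumberField IsDedekindDomain

namespace Summit.ABC.IUTFork.Conditional

open Thm311 Thm311.Real Cor312 Cor312Vol Cor312Prov Literature.IUT.LogThetaLattice Literature.IUT.LogVolume
  Literature.IUT.HodgeTheaters Literature.IUT.LogVolume.ThetaData Literature.IUT.LogVolume.Cor22
open Literature.NumberTheory.NumberFields Literature.NumberTheory.GaloisRepresentations.Ultrametric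
open Literature.NumberTheory.DiophantineGeometry Literature.NumberTheory.DiophantineGeometry.GenEll Summit.ABC.ABC.Theorems
open Summit.ABC.IUTFork.Repair.RH.HullThresholdExact

/-! ## §1. The integer side at `p = 7`, `v = 36`: class `A ∈ {5}`, top label -/

set_option maxHeartbeats 800000 in
/-- **The engine's `hcell` for the HEX36 triple at `p = 7` (`v = 36`), odd `481 ≤ l ≤ 279156616784323` or `l = 279156616784327`, top label.** The sharp clauses force
`A ∈ {5}`; per member and turning-point piece the cell fails by the floor-free lemmas above, at the literal levels by the exact floor. [folklore] -/
theorem RefBand.cells_hex36_band {l : ℕ} (hlo : 481 ≤ l) (hhi : l ≤ 279156616784323 ∨ l = 279156616784327) (hodd : Odd l) {i : ℕ} (hi : i + 1 = (l - 1) / 2)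
    (A : ℕ) (hA30 : A ∣ 30) (hA15 : 15 ∣ A * 36) (hAev : Even 36 → A ∣ 15) (hA3 : 3 ∣ 36 → A ∣ 10) (hA5 : 5 ∣ 36 → A ∣ 6) :
    ∃ a₀ : ℕ, (∀ s : ℕ, s < a₀ → (1 : ℤ) * ((7 : ℕ) : ℤ) ^ s * (((7 : ℕ) : ℤ) - 1) < ((A * l : ℕ) : ℤ)) ∧
      ((A * l : ℕ) : ℤ) ≤ 1 * ((7 : ℕ) : ℤ) ^ a₀ * (((7 : ℕ) : ℤ) - 1) ∧
      ¬ HullCell ((A * l : ℕ) : ℤ) ((A * 36 : ℕ) : ℤ) ((i : ℤ) + 1) (((A * l) / ((7 : ℕ) - 1) + 1 : ℕ) : ℤ)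
        (((7 : ℕ) : ℤ) ^ a₀ - (a₀ : ℤ) * ((A * l : ℕ) : ℤ)) := by
  have h15 : A ∣ 15 := hAev (by decide)
  have h10 : A ∣ 10 := hA3 (by decide)
  have hAg : A ∣ 5 := by
    have := Nat.dvd_gcd h15 h10
    simpa using this
  have hdA : 5 ∣ A := by
    have h' : 5 ∣ A * 36 := Nat.dvd_trans (by norm_num) hA15
    exact (Nat.Coprime.dvd_of_dvd_mul_right (by norm_num : Nat.Coprime 5 36) h')
  have hA : A = 5 := by
    have h1 : A ≤ 5 := Nat.le_of_dvd (by norm_num) hAg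
    have h2 : 0 < A := Nat.pos_of_dvd_of_pos hAg (by norm_num)
    interval_cases A <;> omega
  obtain ⟨j, hj⟩ := hodd
  have hij : (i : ℤ) + 1 = (j : ℤ) := by
    have : i + 1 = j := by omega
    exact_mod_cast this
  rcases hA with rfl
  have hrin : (6 : ℤ) * (((((5 * l) / ((7 : ℕ) - 1) + 1 : ℕ) : ℤ))) ≤ 5 * (2 * (j : ℤ) + 1) + 6 := by
    have h0 : ((7 : ℕ) - 1) * ((5 * l) / ((7 : ℕ) - 1)) ≤ 5 * l := Nat.mul_div_le _ _
    have h1 : (6 : ℤ) * ((((5 * l) / ((7 : ℕ) - 1) : ℕ) : ℤ)) ≤ ((5 * l : ℕ) : ℤ) := by exact_mod_cast h0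
    push_cast at h1 ⊢; omega
  have he : ((5 * l : ℕ) : ℤ) = 5 * (2 * (j : ℤ) + 1) := by push_cast; omega
  have hm : ((5 * 36 : ℕ) : ℤ) = 180 := by norm_num
  by_cases hp0 : 481 ≤ l ∧ l ≤ 2881
  · refine ⟨4, fun s hs => ?_, ?_, ?_⟩
    · interval_cases s <;> norm_num <;> omega
    · norm_num; omega
    · have hro : (((7 : ℕ) : ℤ) ^ 4 - ((4 : ℕ) : ℤ) * ((5 * l : ℕ) : ℤ)) = 2401 - 4 * (5 * (2 * (j : ℤ) + 1)) := by
        push_cast; omega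
      rw [hro, hij, he, hm]; exact RefBand.not_hullCell_hex36_A5_a4 (by omega) (by omega) hrin
  by_cases hp1 : 2883 ≤ l ∧ l ≤ 20167
  · refine ⟨5, fun s hs => ?_, ?_, ?_⟩
    · interval_cases s <;> norm_num <;> omega
    · norm_num; omega
    · have hro : (((7 : ℕ) : ℤ) ^ 5 - ((5 : ℕ) : ℤ) * ((5 * l : ℕ) : ℤ)) = 16807 - 5 * (5 * (2 * (j : ℤ) + 1)) := by
        push_cast; omega
      rw [hro, hij, he, hm]; exact RefBand.not_hullCell_hex36_A5_a5 (by omega) (by omega) hrin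
  by_cases hp2 : 20169 ≤ l ∧ l ≤ 141177
  · refine ⟨6, fun s hs => ?_, ?_, ?_⟩
    · have hs' : ((7 : ℕ) : ℤ) ^ s ≤ ((7 : ℕ) : ℤ) ^ 5 := pow_le_pow_right₀ (by norm_num) (by omega)
      have hl' : ((20169 : ℕ) : ℤ) ≤ (l : ℤ) := by exact_mod_cast hp2.1
      push_cast at hs' hl' ⊢; nlinarith [hs', hl']
    · norm_num; omega
    · have hro : (((7 : ℕ) : ℤ) ^ 6 - ((6 : ℕ) : ℤ) * ((5 * l : ℕ) : ℤ)) = 117649 - 6 * (5 * (2 * (j : ℤ) + 1)) := by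
        push_cast; omega
      rw [hro, hij, he, hm]; exact RefBand.not_hullCell_hex36_A5_a6 (by omega) (by omega) hrin
  by_cases hp3 : 141179 ≤ l ∧ l ≤ 988251
  · refine ⟨7, fun s hs => ?_, ?_, ?_⟩
    · have hs' : ((7 : ℕ) : ℤ) ^ s ≤ ((7 : ℕ) : ℤ) ^ 6 := pow_le_pow_right₀ (by norm_num) (by omega)
      have hl' : ((141179 : ℕ) : ℤ) ≤ (l : ℤ) := by exact_mod_cast hp3.1
      push_cast at hs' hl' ⊢; nlinarith [hs', hl']
    · norm_num; omega
    · have hro : (((7 : ℕ) : ℤ) ^ 7 - ((7 : ℕ) : ℤ) * ((5 * l : ℕ) : ℤ)) = 823543 - 7 * (5 * (2 * (j : ℤ) + 1)) := by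
        push_cast; omega
      rw [hro, hij, he, hm]; exact RefBand.not_hullCell_hex36_A5_a7 (by omega) (by omega) hrin
  by_cases hp4 : 988253 ≤ l ∧ l ≤ 6917761
  · refine ⟨8, fun s hs => ?_, ?_, ?_⟩
    · have hs' : ((7 : ℕ) : ℤ) ^ s ≤ ((7 : ℕ) : ℤ) ^ 7 := pow_le_pow_right₀ (by norm_num) (by omega)
      have hl' : ((988253 : ℕ) : ℤ) ≤ (l : ℤ) := by exact_mod_cast hp4.1
      push_cast at hs' hl' ⊢; nlinarith [hs', hl']
    · norm_num; omega
    · have hro : (((7 : ℕ) : ℤ) ^ 8 - ((8 : ℕ) : ℤ) * ((5 * l : ℕ) : ℤ)) = 5764801 - 8 * (5 * (2 * (j : ℤ) + 1)) := by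
        push_cast; omega
      rw [hro, hij, he, hm]; exact RefBand.not_hullCell_hex36_A5_a8 (by omega) (by omega) hrin
  by_cases hp5 : 6917763 ≤ l ∧ l ≤ 48424327
  · refine ⟨9, fun s hs => ?_, ?_, ?_⟩
    · have hs' : ((7 : ℕ) : ℤ) ^ s ≤ ((7 : ℕ) : ℤ) ^ 8 := pow_le_pow_right₀ (by norm_num) (by omega)
      have hl' : ((6917763 : ℕ) : ℤ) ≤ (l : ℤ) := by exact_mod_cast hp5.1
      push_cast at hs' hl' ⊢; nlinarith [hs', hl']
    · norm_num; omega
    · have hro : (((7 : ℕ) : ℤ) ^ 9 - ((9 : ℕ) : ℤ) * ((5 * l : ℕ) : ℤ)) = 40353607 - 9 * (5 * (2 * (j : ℤ) + 1)) := by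
        push_cast; omega
      rw [hro, hij, he, hm]; exact RefBand.not_hullCell_hex36_A5_a9 (by omega) (by omega) hrin
  by_cases hp6 : 48424329 ≤ l ∧ l ≤ 338970297
  · refine ⟨10, fun s hs => ?_, ?_, ?_⟩
    · have hs' : ((7 : ℕ) : ℤ) ^ s ≤ ((7 : ℕ) : ℤ) ^ 9 := pow_le_pow_right₀ (by norm_num) (by omega)
      have hl' : ((48424329 : ℕ) : ℤ) ≤ (l : ℤ) := by exact_mod_cast hp6.1
      push_cast at hs' hl' ⊢; nlinarith [hs', hl']
    · norm_num; omega
    · have hro : (((7 : ℕ) : ℤ) ^ 10 - ((10 : ℕ) : ℤ) * ((5 * l : ℕ) : ℤ)) = 282475249 - 10 * (5 * (2 * (j : ℤ) + 1)) := by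
        push_cast; omega
      rw [hro, hij, he, hm]; exact RefBand.not_hullCell_hex36_A5_a10 (by omega) (by omega) hrin
  by_cases hp7 : 338970299 ≤ l ∧ l ≤ 2372792091
  · refine ⟨11, fun s hs => ?_, ?_, ?_⟩
    · have hs' : ((7 : ℕ) : ℤ) ^ s ≤ ((7 : ℕ) : ℤ) ^ 10 := pow_le_pow_right₀ (by norm_num) (by omega)
      have hl' : ((338970299 : ℕ) : ℤ) ≤ (l : ℤ) := by exact_mod_cast hp7.1
      push_cast at hs' hl' ⊢; nlinarith [hs', hl']
    · norm_num; omega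
    · have hro : (((7 : ℕ) : ℤ) ^ 11 - ((11 : ℕ) : ℤ) * ((5 * l : ℕ) : ℤ)) = 1977326743 - 11 * (5 * (2 * (j : ℤ) + 1)) := by
        push_cast; omega
      rw [hro, hij, he, hm]; exact RefBand.not_hullCell_hex36_A5_a11 (by omega) (by omega) hrin
  by_cases hp8 : 2372792093 ≤ l ∧ l ≤ 16609544641
  · refine ⟨12, fun s hs => ?_, ?_, ?_⟩
    · have hs' : ((7 : ℕ) : ℤ) ^ s ≤ ((7 : ℕ) : ℤ) ^ 11 := pow_le_pow_right₀ (by norm_num) (by omega)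
      have hl' : ((2372792093 : ℕ) : ℤ) ≤ (l : ℤ) := by exact_mod_cast hp8.1
      push_cast at hs' hl' ⊢; nlinarith [hs', hl']
    · norm_num; omega
    · have hro : (((7 : ℕ) : ℤ) ^ 12 - ((12 : ℕ) : ℤ) * ((5 * l : ℕ) : ℤ)) = 13841287201 - 12 * (5 * (2 * (j : ℤ) + 1)) := by
        push_cast; omega
      rw [hro, hij, he, hm]; exact RefBand.not_hullCell_hex36_A5_a12 (by omega) (by omega) hrin
  by_cases hp9 : 16609544643 ≤ l ∧ l ≤ 116266812487
  · refine ⟨13, fun s hs => ?_, ?_, ?_⟩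
    · have hs' : ((7 : ℕ) : ℤ) ^ s ≤ ((7 : ℕ) : ℤ) ^ 12 := pow_le_pow_right₀ (by norm_num) (by omega)
      have hl' : ((16609544643 : ℕ) : ℤ) ≤ (l : ℤ) := by exact_mod_cast hp9.1
      push_cast at hs' hl' ⊢; nlinarith [hs', hl']
    · norm_num; omega
    · have hro : (((7 : ℕ) : ℤ) ^ 13 - ((13 : ℕ) : ℤ) * ((5 * l : ℕ) : ℤ)) = 96889010407 - 13 * (5 * (2 * (j : ℤ) + 1)) := by
        push_cast; omega
      rw [hro, hij, he, hm]; exact RefBand.not_hullCell_hex36_A5_a13 (by omega) (by omega) hrin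
  by_cases hp10 : 116266812489 ≤ l ∧ l ≤ 813867687417
  · refine ⟨14, fun s hs => ?_, ?_, ?_⟩
    · have hs' : ((7 : ℕ) : ℤ) ^ s ≤ ((7 : ℕ) : ℤ) ^ 13 := pow_le_pow_right₀ (by norm_num) (by omega)
      have hl' : ((116266812489 : ℕ) : ℤ) ≤ (l : ℤ) := by exact_mod_cast hp10.1
      push_cast at hs' hl' ⊢; nlinarith [hs', hl']
    · norm_num; omega
    · have hro : (((7 : ℕ) : ℤ) ^ 14 - ((14 : ℕ) : ℤ) * ((5 * l : ℕ) : ℤ)) = 678223072849 - 14 * (5 * (2 * (j : ℤ) + 1)) := by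
        push_cast; omega
      rw [hro, hij, he, hm]; exact RefBand.not_hullCell_hex36_A5_a14 (by omega) (by omega) hrin
  by_cases hp11 : 813867687419 ≤ l ∧ l ≤ 5697073811931
  · refine ⟨15, fun s hs => ?_, ?_, ?_⟩
    · have hs' : ((7 : ℕ) : ℤ) ^ s ≤ ((7 : ℕ) : ℤ) ^ 14 := pow_le_pow_right₀ (by norm_num) (by omega)
      have hl' : ((813867687419 : ℕ) : ℤ) ≤ (l : ℤ) := by exact_mod_cast hp11.1
      push_cast at hs' hl' ⊢; nlinarith [hs', hl']
    · norm_num; omega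
    · have hro : (((7 : ℕ) : ℤ) ^ 15 - ((15 : ℕ) : ℤ) * ((5 * l : ℕ) : ℤ)) = 4747561509943 - 15 * (5 * (2 * (j : ℤ) + 1)) := by
        push_cast; omega
      rw [hro, hij, he, hm]; exact RefBand.not_hullCell_hex36_A5_a15 (by omega) (by omega) hrin
  by_cases hp12 : 5697073811933 ≤ l ∧ l ≤ 39879516683521
  · refine ⟨16, fun s hs => ?_, ?_, ?_⟩
    · have hs' : ((7 : ℕ) : ℤ) ^ s ≤ ((7 : ℕ) : ℤ) ^ 15 := pow_le_pow_right₀ (by norm_num) (by omega)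
      have hl' : ((5697073811933 : ℕ) : ℤ) ≤ (l : ℤ) := by exact_mod_cast hp12.1
      push_cast at hs' hl' ⊢; nlinarith [hs', hl']
    · norm_num; omega
    · have hro : (((7 : ℕ) : ℤ) ^ 16 - ((16 : ℕ) : ℤ) * ((5 * l : ℕ) : ℤ)) = 33232930569601 - 16 * (5 * (2 * (j : ℤ) + 1)) := by
        push_cast; omega
      rw [hro, hij, he, hm]; exact RefBand.not_hullCell_hex36_A5_a16 (by omega) (by omega) hrin
  by_cases hp13 : 39879516683523 ≤ l ∧ l ≤ 279156616784323
  · refine ⟨17, fun s hs => ?_, ?_, ?_⟩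
    · have hs' : ((7 : ℕ) : ℤ) ^ s ≤ ((7 : ℕ) : ℤ) ^ 16 := pow_le_pow_right₀ (by norm_num) (by omega)
      have hl' : ((39879516683523 : ℕ) : ℤ) ≤ (l : ℤ) := by exact_mod_cast hp13.1
      push_cast at hs' hl' ⊢; nlinarith [hs', hl']
    · norm_num; omega
    · have hro : (((7 : ℕ) : ℤ) ^ 17 - ((17 : ℕ) : ℤ) * ((5 * l : ℕ) : ℤ)) = 232630513987207 - 17 * (5 * (2 * (j : ℤ) + 1)) := by
        push_cast; omega
      rw [hro, hij, he, hm]; exact RefBand.not_hullCell_hex36_A5_a17 (by omega) (by omega) hrin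
  -- remaining levels: the literal primes [279156616784327] (exact floor)
  have hlit : l = 279156616784327 := by omega
  rcases hlit with rfl
  have hj' : (j : ℤ) = 139578308392163 := by omega
  refine ⟨17, fun s hs => ?_, by norm_num, ?_⟩
  · interval_cases s <;> norm_num
  · rw [hij, hj']; norm_num [HullCell]

end Summit.ABC.IUTFork.Conditional

end
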